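import Mathlib
import HarnessLib
import Summits.NavierStokesRegularity.NavierStokesRegularity.Theorems.ChiralWindowDoorDefs
import Summits.NavierStokesRegularity.NavierStokesRegularity.Theorems.ChiralWindowDoorLambda
import Summits.NavierStokesRegularity.NavierStokesRegularity.Theorems.ChiralWindowDoorZoomLambdaTools
import Summits.NavierStokesRegularity.NavierStokesRegularity.Theorems.ChiralWindowDoorZoomLambdaLimit
import Summits.NavierStokesRegularity.NavierStokesRegularity.Theorems.ChiralWindowDoorZoomLambdaFrameHelpers
import Summits.NavierStokesRegularity.NavierStokesRegularity.Theorems.LocalSineTubeDoorLocalPointZoomData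
import Summits.NavierStokesRegularity.NavierStokesRegularity.Theorems.LocalVelCompTubeDoorLocalPointZoomVel
import Summits.NavierStokesRegularity.NavierStokesRegularity.Theorems.LocalSineTubeDoorLocalPointZoomCurl

/-!
# Door S20 «ChiralWindowDoor» — zoom crux K1, frame level: `Λ` of the rescaled slices converges to `Λ` of the
# profile slice at time `−1` (the three-zone argument run on the tree zoom frame)

Door S20 of nsreg-p1's local Type-I door family (DESIGN-ONLY, route NOT born).  On the local tree zoom frame of the
door family (`…LocalSineTubeDoorLocalPointZoomFrame.localTreeZoomFrame`: zooms `Z_j` of a classical Leray–Hopf flow at a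
locally Type-I, non-backward-bounded point, with `L³_loc` limit `v₁` in the profile class), at the slice `s = −1` and
every `y`:

* `localZoomFrame_fracLapHalf_tendsto` — **`Λ(Z_j(−1,·))(y) → Λ(v₁(−1,·))(y)`**, `Λ = fracLapHalf`.

Zones: (1) `‖z‖ < 7/8` — uniform `C²` bounds of the smooth representatives of the zooms on `Q_{7/8}((−½,y))`
(`NSBoundedHigherRegularityBounds_holds`, Seregin–Šverák), as in `…LocalPointZoomCurl`; (2) `‖y+z‖ < ρ/(2μ_j)` — the
LOCAL Type-I bound `‖Z_j(−1,·)‖ ≤ M/ν` read off the original flow; (3) beyond — the Leray–Hopf `L²` mass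
`∫‖Z_j(−1,·)‖² = μ_j⁻¹ν⁻²∫‖u(t_j)‖² ≤ μ_j⁻¹ν⁻²E₀`, supercritical but beaten by the kernel tail `∫_{‖z‖≥L}lamK² ≲ L⁻⁵`
with `L ∼ ρ/μ_j` (AM–GM, `…ZoomLambdaTools.integral_tail_shift_le`); pointwise convergence everywhere is the level-zero
upgrade `localZoomFrame_tendsto`; assembly `…ZoomLambdaLimit.tendsto_fracLapHalf_of_zones`.

Seat nsreg-p6 g12 (THEOREMS-ONLY door sequels, DIRECTOR-NS g8 #32 (2)/#36).  WHAT THIS IS NOT: not NS regularity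
(Clay A); not K1 yet (the `√(−s)`-rescaling to general slices and the window Fatou glue follow); no route is opened.
-/

noncomputable section

-- the summit and its single sub-problem share the name (CONVENTIONS §1), as in every Theorems file
set_option linter.dupNamespace false

namespace Summit.NavierStokesRegularity.NavierStokesRegularity.Theorems.ChiralWindowDoorZoomLambdaFrame

open MeasureTheory Set Filter Topology TopologicalSpace Metric Function
open scoped RealInnerProductSpace NNReal ENNReal
open Literature.Analysis Literature.Analysis.FluidPDE Literature.Analysis.FluidPDE.SereginSverak2009
open Summit.NavierStokesRegularity.NavierStokesRegularity.Theorems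
open Summit.NavierStokesRegularity.NavierStokesRegularity.Theorems.ChiralWindowDoorDefs
open Summit.NavierStokesRegularity.NavierStokesRegularity.Theorems.ChiralWindowDoorZoomLambdaTools
open Summit.NavierStokesRegularity.NavierStokesRegularity.Theorems.ChiralWindowDoorZoomLambdaLimit
open Summit.NavierStokesRegularity.NavierStokesRegularity.Theorems.ChiralWindowDoorZoomLambdaFrameHelpers
open Summit.NavierStokesRegularity.NavierStokesRegularity.Theorems.LocalSineTubeDoorLocalPointZoomData
open Summit.NavierStokesRegularity.NavierStokesRegularity.Theorems.LocalVelCompTubeDoorLocalPointZoomVel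
open Summit.NavierStokesRegularity.NavierStokesRegularity.Theorems.LocalSineTubeDoorProfileAlignedWindowRigidityAncient
  (analyticOnNhd_slice bdd_of_hasTypeITimeDecay)

/-- **Zone 1: uniform `C²` control of the zoomed slices near `y`.**  On the local tree zoom frame there are `J` and
`A ≥ 0` such that for `j ≥ J` the zoom time lies in `[0,T)` (`(Rλ_j/2)²·2 < νT`) and the zoomed slice at `s = −1`
agrees near every point of `B_{7/8}(y)` with a smooth representative whose second derivative is bounded by `A` there:
`‖iteratedFDeriv ℝ 2 (Z_j(−1,·)) y'‖ ≤ A` for `y' ∈ B_{7/8}(y)` (Seregin–Šverák representatives,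
`NSBoundedHigherRegularityBounds_holds`, as in `…LocalPointZoomCurl`). -/
theorem localZoomFrame_secondDeriv_bound {ν T : ℝ} (hν : 0 < ν) (hT : 0 < T)
    {u : ℝ → (EuclideanSpace ℝ (Fin 3)) → (EuclideanSpace ℝ (Fin 3))}
    (hcont : ContinuousOn (uncurry u) (Ico 0 T ×ˢ univ)) {x₀ : (EuclideanSpace ℝ (Fin 3))} {ρ M : ℝ} (hρ : 0 < ρ)
    (hM : ∀ t ∈ Ico 0 T, T - ρ ^ 2 < t → ∀ x ∈ ball x₀ ρ, ‖u t x‖ * Real.sqrt (ν * (T - t)) ≤ M)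
    {R : ℝ} (hR : 0 < R) {v' : ℝ → (EuclideanSpace ℝ (Fin 3)) → (EuclideanSpace ℝ (Fin 3))} {π' : ℝ → (EuclideanSpace ℝ (Fin 3)) → ℝ}
    (hball1 : IsSuitableWeakSolutionInBall 1 0 v' π') {lam : ℕ → ℝ} (hlam : ∀ j, 0 < lam j)
    (hlam0 : Tendsto lam atTop (𝓝 0)) {Ks : ℝ≥0} {r₁ : ℝ} (hr₁ : 0 < r₁) (hr₁1 : r₁ ≤ 1)
    (hKs : ∀ r ∈ Ioc (0 : ℝ) r₁, cknD r (0 : ℝ × (EuclideanSpace ℝ (Fin 3))) π' ≤ Ks)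
    (hpt : ∀ (j : ℕ) (s : ℝ) (y : (EuclideanSpace ℝ (Fin 3))), ((lam j) • stPull ((lam j) ^ 2) (lam j) (0 : ℝ) (0 : (EuclideanSpace ℝ (Fin 3))) v') s y =
      ((R * (lam j / 2)) / ν) • u (T + (R * (lam j / 2)) ^ 2 * s / ν) (x₀ + (R * (lam j / 2)) • y)) (y : (EuclideanSpace ℝ (Fin 3))) :
    ∃ (J : ℕ) (A : ℝ), 0 ≤ A ∧ ∀ j, J ≤ j → (R * (lam j / 2)) ^ 2 * 2 < ν * T ∧
      ∀ y' ∈ ball y (7 / 8), ‖iteratedFDeriv ℝ 2 (((lam j) • stPull ((lam j) ^ 2) (lam j) (0 : ℝ) (0 : (EuclideanSpace ℝ (Fin 3))) v') (-1)) y'‖ ≤ A := by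
  obtain ⟨J, hJ⟩ := localZoomFrame_data hν hT hρ hM hR hball1 hlam hlam0 hr₁ hr₁1 hKs hpt y
  have hΛpos : ∀ j, 0 < (R * (lam j / 2)) := fun j => mul_pos hR (half_pos (hlam j))
  have hmemQ : ∀ {r : ℝ} {q : ℝ × (EuclideanSpace ℝ (Fin 3))},
      q ∈ parabolicCylinder r ((-(1 / 2) : ℝ), y) ↔
        (-(1 / 2) - r ^ 2 < q.1 ∧ q.1 < -(1 / 2)) ∧ dist q.2 y < r := by
    intro r q
    simp only [parabolicCylinder, mem_prod, mem_Ioo, mem_ball]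
  have htime : ∀ j, J ≤ j → ∀ s : ℝ, -(3 / 2) < s → s < -(1 / 2) →
      T + (R * (lam j / 2)) ^ 2 * s / ν ∈ Ico 0 T := by
    intro j hj s hs1 hs2
    have hC := (hJ j hj).1
    have hΛ2 : 0 < (R * (lam j / 2)) ^ 2 := pow_pos (hΛpos j) 2
    refine ⟨?_, ?_⟩
    · have key : 0 ≤ ν * T + (R * (lam j / 2)) ^ 2 * s := by nlinarith
      have e : T + (R * (lam j / 2)) ^ 2 * s / ν = (ν * T + (R * (lam j / 2)) ^ 2 * s) / ν := by
        field_simp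
      rw [e]
      exact div_nonneg key hν.le
    · have : (R * (lam j / 2)) ^ 2 * s / ν < 0 := div_neg_of_neg_of_pos (by nlinarith) hν
      linarith
  obtain ⟨Kr, Cr, αr, hαr, hreg⟩ := NSBoundedHigherRegularityBounds_holds (1 : ℝ)
    (M * Real.sqrt 2 / ν) (((‖y‖ + 2) ^ 2).toNNReal * Ks)
  have hch : ∀ j, ∃ V : ℝ → (EuclideanSpace ℝ (Fin 3)) → (EuclideanSpace ℝ (Fin 3)), J ≤ j →
      (uncurry ((lam j) • stPull ((lam j) ^ 2) (lam j) (0 : ℝ) (0 : (EuclideanSpace ℝ (Fin 3))) v') =ᵐ[volume.restrict (parabolicCylinder 1 ((-(1 / 2) : ℝ), y))] uncurry V) ∧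
      (∀ w ∈ parabolicCylinder 1 ((-(1 / 2) : ℝ), y), ContDiffAt ℝ (⊤ : ℕ∞) (V w.1) w.2) ∧
      ∀ n : ℕ, ∀ r ∈ Ioo (0 : ℝ) 1,
        HolderOnWith (Cr n r) (αr n r) (fun w : ℝ × (EuclideanSpace ℝ (Fin 3)) => iteratedFDeriv ℝ n (V w.1) w.2)
          (parabolicCylinder r ((-(1 / 2) : ℝ), y)) ∧
        ∀ w ∈ parabolicCylinder r ((-(1 / 2) : ℝ), y), ‖iteratedFDeriv ℝ n (V w.1) w.2‖ ≤ Kr n r := by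
    intro j
    by_cases hj : J ≤ j
    · obtain ⟨V, hV⟩ := hreg ((lam j) • stPull ((lam j) ^ 2) (lam j) (0 : ℝ) (0 : (EuclideanSpace ℝ (Fin 3))) v') ((lam j) ^ 2 • stPull ((lam j) ^ 2) (lam j) (0 : ℝ) (0 : (EuclideanSpace ℝ (Fin 3))) π') ((-(1 / 2) : ℝ), y) (hJ j hj).2.1 (hJ j hj).2.2.1 (hJ j hj).2.2.2
      exact ⟨V, fun _ => hV⟩
    · exact ⟨fun _ _ => 0, fun h => absurd h hj⟩
  choose V hV using hch
  have h78 : (7 / 8 : ℝ) ∈ Ioo (0 : ℝ) 1 := ⟨by norm_num, by norm_num⟩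
  have hQ71 : parabolicCylinder (7 / 8) ((-(1 / 2) : ℝ), y) ⊆ parabolicCylinder 1 ((-(1 / 2) : ℝ), y) := by
    intro q hq
    rw [hmemQ] at hq ⊢
    obtain ⟨⟨h1, h2⟩, h3⟩ := hq
    exact ⟨⟨by linarith, h2⟩, by linarith⟩
  have hmem7 : ∀ y' ∈ ball y (7 / 8), ((-1 : ℝ), y') ∈ parabolicCylinder (7 / 8) ((-(1 / 2) : ℝ), y) := by
    intro y' hy'
    rw [hmemQ]
    exact ⟨⟨by norm_num, by norm_num⟩, mem_ball.1 hy'⟩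
  have hZcont : ∀ j, J ≤ j → ContinuousOn (uncurry ((lam j) • stPull ((lam j) ^ 2) (lam j) (0 : ℝ) (0 : (EuclideanSpace ℝ (Fin 3))) v')) (parabolicCylinder 1 ((-(1 / 2) : ℝ), y)) := by
    intro j hj
    have hφ : Continuous fun q : ℝ × (EuclideanSpace ℝ (Fin 3)) => (T + (R * (lam j / 2)) ^ 2 * q.1 / ν, x₀ + (R * (lam j / 2)) • q.2) := by
      fun_prop
    have hmaps : MapsTo (fun q : ℝ × (EuclideanSpace ℝ (Fin 3)) => (T + (R * (lam j / 2)) ^ 2 * q.1 / ν, x₀ + (R * (lam j / 2)) • q.2))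
        (parabolicCylinder 1 ((-(1 / 2) : ℝ), y)) (Ico 0 T ×ˢ univ) := by
      intro q hq
      rw [hmemQ] at hq
      exact mem_prod.2 ⟨htime j hj q.1 (by linarith [hq.1.1]) hq.1.2, mem_univ _⟩
    have hc := (hcont.comp hφ.continuousOn hmaps).const_smul ((R * (lam j / 2)) / ν)
    refine hc.congr fun q _ => ?_
    exact hpt j q.1 q.2
  have hVH : ∀ j, J ≤ j → HolderOnWith (Cr 0 (7 / 8)) (αr 0 (7 / 8))
      (fun w : ℝ × (EuclideanSpace ℝ (Fin 3)) => V j w.1 w.2) (parabolicCylinder (7 / 8) ((-(1 / 2) : ℝ), y)) := by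
    intro j hj w hw w' hw'
    have h := ((hV j hj).2.2 0 (7 / 8) h78).1 w hw w' hw'
    simpa only [iteratedFDeriv_zero_eq_comp, Function.comp_apply, LinearIsometryEquiv.edist_map]
      using h
  have hVcont : ∀ j, J ≤ j → ContinuousOn (uncurry (V j))
      (parabolicCylinder (7 / 8) ((-(1 / 2) : ℝ), y)) := fun j hj =>
    ((hVH j hj).uniformContinuousOn (hαr 0 (7 / 8) h78)).continuousOn
  have hEqOn : ∀ j, J ≤ j → EqOn (uncurry ((lam j) • stPull ((lam j) ^ 2) (lam j) (0 : ℝ) (0 : (EuclideanSpace ℝ (Fin 3))) v')) (uncurry (V j))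
      (parabolicCylinder (7 / 8) ((-(1 / 2) : ℝ), y)) := fun j hj =>
    Measure.eqOn_open_of_ae_eq (ae_restrict_of_ae_restrict_of_subset hQ71 (hV j hj).1)
      (isOpen_parabolicCylinder _ _) ((hZcont j hj).mono hQ71) (hVcont j hj)
  refine ⟨J, (Kr 2 (7 / 8) : ℝ), NNReal.coe_nonneg _, fun j hj => ⟨(hJ j hj).1, fun y' hy' => ?_⟩⟩
  have hZV : ((lam j) • stPull ((lam j) ^ 2) (lam j) (0 : ℝ) (0 : (EuclideanSpace ℝ (Fin 3))) v') (-1) =ᶠ[𝓝 y'] V j (-1) := by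
    filter_upwards [isOpen_ball.mem_nhds hy'] with y'' hy''
    exact hEqOn j hj (hmem7 y'' hy'')
  rw [(Filter.EventuallyEq.iteratedFDeriv ℝ hZV 2).eq_of_nhds]
  exact ((hV j hj).2.2 2 (7 / 8) h78).2 ((-1 : ℝ), y') (hmem7 y' hy')

/-- **Zones 2–3 data of one zoomed slice.**  For a classical solution on `[0,T)` locally Type I about `(x₀,T)` with
`∫‖u(t)‖² ≤ E₀`, and a scale `0 < μ` with `2μ² < νT`, `μ² < νρ²`: the slice `y' ↦ (μ/ν) u(T − μ²/ν, x₀ + μy')` is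
`C²`, bounded by `M/ν` on `μ‖y'‖ < ρ`, and has `L²` mass `≤ (μ/ν)² μ⁻³ E₀`. -/
theorem zoomSlice_bounds {ν T : ℝ} (hν : 0 < ν)
    {u : ℝ → (EuclideanSpace ℝ (Fin 3)) → (EuclideanSpace ℝ (Fin 3))} {p : ℝ → (EuclideanSpace ℝ (Fin 3)) → ℝ}
    (hsol : IsClassicalNSSolutionOn (Ico 0 T) ν 0 u p) {x₀ : (EuclideanSpace ℝ (Fin 3))} {ρ M : ℝ}
    (hM : ∀ t ∈ Ico 0 T, T - ρ ^ 2 < t → ∀ x ∈ ball x₀ ρ, ‖u t x‖ * Real.sqrt (ν * (T - t)) ≤ M)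
    {E₀ : ℝ} (hEn : ∀ t ∈ Ico 0 T, Integrable (fun x => ‖u t x‖ ^ 2) ∧ ∫ x, ‖u t x‖ ^ 2 ≤ E₀)
    {μ : ℝ} (hμ : 0 < μ) (hμT : μ ^ 2 * 2 < ν * T) (hμρ : μ ^ 2 < ν * ρ ^ 2) :
    T + μ ^ 2 * (-1) / ν ∈ Ico 0 T ∧
    ContDiff ℝ 2 (fun y' : EuclideanSpace ℝ (Fin 3) => (μ / ν) • u (T + μ ^ 2 * (-1) / ν) (x₀ + μ • y')) ∧
    (∀ y' : EuclideanSpace ℝ (Fin 3), μ * ‖y'‖ < ρ → ‖(μ / ν) • u (T + μ ^ 2 * (-1) / ν) (x₀ + μ • y')‖ ≤ M / ν) ∧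
    Integrable (fun w : EuclideanSpace ℝ (Fin 3) => ‖(μ / ν) • u (T + μ ^ 2 * (-1) / ν) (x₀ + μ • w)‖ ^ 2) ∧
    ∫ w : EuclideanSpace ℝ (Fin 3), ‖(μ / ν) • u (T + μ ^ 2 * (-1) / ν) (x₀ + μ • w)‖ ^ 2 ≤ (μ / ν) ^ 2 * (μ ^ 3)⁻¹ * E₀ := by
  set t : ℝ := T + μ ^ 2 * (-1) / ν with htdef
  have hμ2 : 0 < μ ^ 2 := pow_pos hμ 2
  have ht : t ∈ Ico 0 T := by
    refine ⟨?_, ?_⟩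
    · have key : 0 ≤ ν * T + μ ^ 2 * (-1) := by nlinarith
      have e : t = (ν * T + μ ^ 2 * (-1)) / ν := by rw [htdef]; field_simp
      rw [e]; exact div_nonneg key hν.le
    · have : μ ^ 2 * (-1) / ν < 0 := div_neg_of_neg_of_pos (by nlinarith) hν
      show T + μ ^ 2 * (-1) / ν < T
      linarith
  refine ⟨ht, ?_, ?_, ?_⟩
  · have hu : ContDiff ℝ 2 (u t) := (hsol.contDiff_velocity ht).of_le (by norm_cast)
    exact (hu.comp ((contDiff_const).add (contDiff_const_smul μ))).const_smul _
  · intro y' hy'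
    have hx : x₀ + μ • y' ∈ ball x₀ ρ := by
      rw [mem_ball, dist_eq_norm, add_sub_cancel_left, norm_smul, Real.norm_eq_abs, abs_of_pos hμ]
      exact hy'
    have hwin : T - ρ ^ 2 < t := by
      have : μ ^ 2 / ν < ρ ^ 2 := by rw [div_lt_iff₀ hν]; linarith
      have e : t = T - μ ^ 2 / ν := by rw [htdef]; ring
      rw [e]; linarith
    have h := hM t ht hwin _ hx
    have hsq : Real.sqrt (ν * (T - t)) = μ := by
      have e : ν * (T - t) = μ ^ 2 := by rw [htdef]; field_simp; ring
      rw [e, Real.sqrt_sq hμ.le]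
    rw [hsq] at h
    rw [norm_smul, Real.norm_eq_abs, abs_of_pos (div_pos hμ hν)]
    calc μ / ν * ‖u t (x₀ + μ • y')‖ = (‖u t (x₀ + μ • y')‖ * μ) / ν := by ring
      _ ≤ M / ν := div_le_div_of_nonneg_right h hν.le
  · obtain ⟨hui, huE⟩ := hEn t ht
    obtain ⟨hi, hv⟩ := integral_normSq_zoomSlice hui (μ / ν) hμ x₀
    exact ⟨hi, hv.le.trans (mul_le_mul_of_nonneg_left huE
      (mul_nonneg (sq_nonneg _) (inv_nonneg.2 (pow_nonneg hμ.le 3))))⟩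

/-- **`Λ` ALONG THE ZOOM AT THE SLICE `−1`.**  On the local tree zoom frame (hypotheses as in
`…LocalPointZoomCurl.localZoomFrame_curl_tendsto`, plus the classical solution for the smoothness of the slices and a
uniform `L²` bound `∫‖u(t)‖² ≤ E₀` on `[0,T)` for the far field), for every `y`:
`fracLapHalf (Z_j (−1)) y → fracLapHalf (v₁ (−1)) y`. -/
theorem localZoomFrame_fracLapHalf_tendsto {ν T : ℝ} (hν : 0 < ν) (hT : 0 < T)
    {u : ℝ → (EuclideanSpace ℝ (Fin 3)) → (EuclideanSpace ℝ (Fin 3))} {p : ℝ → (EuclideanSpace ℝ (Fin 3)) → ℝ}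
    (hsol : IsClassicalNSSolutionOn (Ico 0 T) ν 0 u p) {x₀ : (EuclideanSpace ℝ (Fin 3))} {ρ M : ℝ} (hρ : 0 < ρ)
    (hM : ∀ t ∈ Ico 0 T, T - ρ ^ 2 < t → ∀ x ∈ ball x₀ ρ, ‖u t x‖ * Real.sqrt (ν * (T - t)) ≤ M)
    {E₀ : ℝ} (hEn : ∀ t ∈ Ico 0 T, Integrable (fun x => ‖u t x‖ ^ 2) ∧ ∫ x, ‖u t x‖ ^ 2 ≤ E₀)
    {R : ℝ} (hR : 0 < R) {v' : ℝ → (EuclideanSpace ℝ (Fin 3)) → (EuclideanSpace ℝ (Fin 3))} {π' : ℝ → (EuclideanSpace ℝ (Fin 3)) → ℝ}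
    (hball1 : IsSuitableWeakSolutionInBall 1 0 v' π') {lam : ℕ → ℝ} (hlam : ∀ j, 0 < lam j)
    (hlam0 : Tendsto lam atTop (𝓝 0)) {Ks : ℝ≥0} {r₁ : ℝ} (hr₁ : 0 < r₁) (hr₁1 : r₁ ≤ 1)
    (hKs : ∀ r ∈ Ioc (0 : ℝ) r₁, cknD r (0 : ℝ × (EuclideanSpace ℝ (Fin 3))) π' ≤ Ks)
    (hpt : ∀ (j : ℕ) (s : ℝ) (y : (EuclideanSpace ℝ (Fin 3))), ((lam j) • stPull ((lam j) ^ 2) (lam j) (0 : ℝ) (0 : (EuclideanSpace ℝ (Fin 3))) v') s y =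
      ((R * (lam j / 2)) / ν) • u (T + (R * (lam j / 2)) ^ 2 * s / ν) (x₀ + (R * (lam j / 2)) • y))
    {w v₁ : ℝ → (EuclideanSpace ℝ (Fin 3)) → (EuclideanSpace ℝ (Fin 3))}
    (hL3 : ∀ a : ℝ, 0 < a → Tendsto (fun j => eLpNorm (uncurry ((lam j) • stPull ((lam j) ^ 2) (lam j) (0 : ℝ) (0 : (EuclideanSpace ℝ (Fin 3))) v') - uncurry w) 3
      (volume.restrict (parabolicCylinder a (0 : ℝ × (EuclideanSpace ℝ (Fin 3)))))) atTop (𝓝 0))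
    (hae : ∀ᵐ x ∂(volume.restrict (Iio (0 : ℝ) ×ˢ (univ : Set (EuclideanSpace ℝ (Fin 3))))), uncurry w x = uncurry v₁ x)
    {C₁ : ℝ} (hv₁rate : HasTypeITimeDecay C₁ v₁) (hv₁cont : ContinuousOn (uncurry v₁) (Iio (0 : ℝ) ×ˢ univ))
    (hv₁mild : ∀ s t : ℝ, s < t → t < 0 → ∀ x,
      v₁ t x = UnboundedOperators.heatExtension (v₁ s) (t - s) x - oseenDuhamel 1 s v₁ v₁ t x)
    (y : (EuclideanSpace ℝ (Fin 3))) :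
    Tendsto (fun j => fracLapHalf (((lam j) • stPull ((lam j) ^ 2) (lam j) (0 : ℝ) (0 : (EuclideanSpace ℝ (Fin 3))) v') (-1)) y)
      atTop (𝓝 (fracLapHalf (v₁ (-1)) y)) := by
  have hcont : ContinuousOn (uncurry u) (Ico 0 T ×ˢ univ) := hsol.smooth_velocity.continuousOn
  obtain ⟨J, A, hA0, hJ⟩ := localZoomFrame_secondDeriv_bound hν hT hcont hρ hM hR hball1 hlam hlam0 hr₁ hr₁1 hKs hpt y
  -- ## the scales `μ_j = R λ_j / 2 → 0`
  have hμpos : ∀ j, 0 < R * (lam j / 2) := fun j => mul_pos hR (half_pos (hlam j))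
  have hμ0 : Tendsto (fun j => R * (lam j / 2)) atTop (𝓝 0) := by simpa using (hlam0.div_const 2).const_mul R
  -- the zoomed slice at `−1` as a rescaled slice of `u`
  have hZfun : ∀ j, ((lam j) • stPull ((lam j) ^ 2) (lam j) (0 : ℝ) (0 : (EuclideanSpace ℝ (Fin 3))) v') (-1) =
      fun y' => (R * (lam j / 2) / ν) • u (T + (R * (lam j / 2)) ^ 2 * (-1) / ν) (x₀ + (R * (lam j / 2)) • y') :=
    fun j => funext fun y' => hpt j (-1) y'
  -- ## eventual regime: `j ≥ J`, `μ_j² < νρ²`, `μ_j(‖y‖+1) ≤ ρ/4`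
  have hev : ∀ᶠ j in atTop, J ≤ j ∧ (R * (lam j / 2)) ^ 2 < ν * ρ ^ 2 ∧ R * (lam j / 2) * (‖y‖ + 1) ≤ ρ / 4 := by
    refine (eventually_ge_atTop J).and ((Filter.Tendsto.eventually_lt_const (by positivity) ?_).and ?_)
    · simpa using hμ0.pow 2
    · have h : Tendsto (fun j => R * (lam j / 2) * (‖y‖ + 1)) atTop (𝓝 0) := by simpa using hμ0.mul_const (‖y‖ + 1)
      filter_upwards [Filter.Tendsto.eventually_lt_const (by positivity : (0 : ℝ) < ρ / 4) h] with j hj using hj.le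
  -- ## the limit slice: bounded, locally `C²`
  have hgB : ∀ w', ‖v₁ (-1) w'‖ ≤ C₁ / Real.sqrt (-(-1 : ℝ)) := fun w' => hv₁rate (-1) (by norm_num) w'
  have hCg0 : 0 ≤ C₁ / Real.sqrt (-(-1 : ℝ)) := (norm_nonneg _).trans (hgB 0)
  have hgcd : ContDiff ℝ 2 (v₁ (-1)) :=
    (analyticOnNhd_slice hv₁cont (bdd_of_hasTypeITimeDecay hv₁rate) hv₁mild (by norm_num : (-1 : ℝ) < 0)).contDiff
  have hgc : Continuous (v₁ (-1)) := hgcd.continuous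
  obtain ⟨Kv, hKv⟩ := (isCompact_closedBall y 1).exists_bound_of_continuousOn
    ((hgcd.continuous_iteratedFDeriv le_rfl).continuousOn)
  have hKv0 : 0 ≤ Kv := (norm_nonneg _).trans (hKv y (mem_closedBall_self zero_le_one))
  have hgnear : ∀ z : EuclideanSpace ℝ (Fin 3), ‖z‖ < 1 →
      ‖(2 : ℝ) • v₁ (-1) y - v₁ (-1) (y + z) - v₁ (-1) (y - z)‖ ≤ 2 * Kv * ‖z‖ ^ 2 := by
    intro z hz
    refine norm_secondDiff_le_of_ball (hgcd.differentiable (by norm_num))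
      (fun y' _ => ((hgcd.fderiv_right (m := 1) (by norm_num)).differentiable (by norm_num)) y')
      (fun y' hy' => ?_) hKv0 hz
    rw [← norm_iteratedFDeriv_one (𝕜 := ℝ) (fderiv ℝ (v₁ (-1))), norm_iteratedFDeriv_fderiv]
    exact hKv y' (ball_subset_closedBall hy')
  -- ## the kernel tail constant, the limit's integrability
  obtain ⟨c, hc0, hc⟩ := exists_lamK_tail_const
  have hgint : Integrable (fun z => lamK z • ((2 : ℝ) • v₁ (-1) y - v₁ (-1) (y + z) - v₁ (-1) (y - z))) := by
    obtain ⟨⟨htp, -⟩, ⟨htm, -⟩⟩ := integrableOn_tail_of_bounded hc hgc.aestronglyMeasurable hgB y one_pos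
    exact integrable_fracLapHalf_integrand_of_near_of_tails hgc.aestronglyMeasurable one_pos (by positivity)
      hgnear htp htm
  -- ## per-`j` package in the eventual regime (zones 2–3 data)
  have hE₀ : 0 ≤ E₀ := by
    obtain ⟨-, h⟩ := hEn 0 ⟨le_rfl, hT⟩
    exact (integral_nonneg fun x => by positivity).trans h
  have hpkg : ∀ j, J ≤ j → (R * (lam j / 2)) ^ 2 < ν * ρ ^ 2 →
      ContDiff ℝ 2 (((lam j) • stPull ((lam j) ^ 2) (lam j) (0 : ℝ) (0 : (EuclideanSpace ℝ (Fin 3))) v') (-1)) ∧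
      (∀ y' : EuclideanSpace ℝ (Fin 3), R * (lam j / 2) * ‖y'‖ < ρ → ‖((lam j) • stPull ((lam j) ^ 2) (lam j) (0 : ℝ) (0 : (EuclideanSpace ℝ (Fin 3))) v') (-1) y'‖ ≤ M / ν) ∧
      Integrable (fun w' => ‖((lam j) • stPull ((lam j) ^ 2) (lam j) (0 : ℝ) (0 : (EuclideanSpace ℝ (Fin 3))) v') (-1) w'‖ ^ 2) ∧
      ∫ w', ‖((lam j) • stPull ((lam j) ^ 2) (lam j) (0 : ℝ) (0 : (EuclideanSpace ℝ (Fin 3))) v') (-1) w'‖ ^ 2 ≤ (R * (lam j / 2) / ν) ^ 2 * ((R * (lam j / 2)) ^ 3)⁻¹ * E₀ := by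
    intro j hj hj2
    obtain ⟨-, h1, h2, h3, h4⟩ := zoomSlice_bounds (x₀ := x₀) hν hsol hM hEn (hμpos j) (hJ j hj).1 hj2
    rw [hZfun j]
    exact ⟨h1, h2, h3, h4⟩
  -- ## ZONE 1: the near bound
  have hnear_of : ∀ j, J ≤ j → (R * (lam j / 2)) ^ 2 < ν * ρ ^ 2 → ∀ z : EuclideanSpace ℝ (Fin 3), ‖z‖ < 7 / 8 →
      ‖(2 : ℝ) • ((lam j) • stPull ((lam j) ^ 2) (lam j) (0 : ℝ) (0 : (EuclideanSpace ℝ (Fin 3))) v') (-1) y - ((lam j) • stPull ((lam j) ^ 2) (lam j) (0 : ℝ) (0 : (EuclideanSpace ℝ (Fin 3))) v') (-1) (y + z) - ((lam j) • stPull ((lam j) ^ 2) (lam j) (0 : ℝ) (0 : (EuclideanSpace ℝ (Fin 3))) v') (-1) (y - z)‖ ≤ 2 * A * ‖z‖ ^ 2 := by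
    intro j hj hj2 z hz
    obtain ⟨hsm, -, -, -⟩ := hpkg j hj hj2
    refine norm_secondDiff_le_of_ball (hsm.differentiable (by norm_num))
      (fun y' _ => ((hsm.fderiv_right (m := 1) (by norm_num)).differentiable (by norm_num)) y')
      (fun y' hy' => ?_) hA0 hz
    rw [← norm_iteratedFDeriv_one (𝕜 := ℝ) (fderiv ℝ (((lam j) • stPull ((lam j) ^ 2) (lam j) (0 : ℝ) (0 : (EuclideanSpace ℝ (Fin 3))) v') (-1))), norm_iteratedFDeriv_fderiv]
    exact (hJ j hj).2 y' hy'
  have hnear : ∀ᶠ j in atTop, ∀ z : EuclideanSpace ℝ (Fin 3), ‖z‖ < 7 / 8 →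
      ‖(2 : ℝ) • ((lam j) • stPull ((lam j) ^ 2) (lam j) (0 : ℝ) (0 : (EuclideanSpace ℝ (Fin 3))) v') (-1) y - ((lam j) • stPull ((lam j) ^ 2) (lam j) (0 : ℝ) (0 : (EuclideanSpace ℝ (Fin 3))) v') (-1) (y + z) - ((lam j) • stPull ((lam j) ^ 2) (lam j) (0 : ℝ) (0 : (EuclideanSpace ℝ (Fin 3))) v') (-1) (y - z)‖ ≤ 2 * A * ‖z‖ ^ 2 := by
    filter_upwards [hev] with j hj using hnear_of j hj.1 hj.2.1
  -- ## pointwise convergence everywhere (level-zero upgrade)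
  have hptw : ∀ y', Tendsto (fun j => ((lam j) • stPull ((lam j) ^ 2) (lam j) (0 : ℝ) (0 : (EuclideanSpace ℝ (Fin 3))) v') (-1) y') atTop (𝓝 (v₁ (-1) y')) := fun y' =>
    localZoomFrame_tendsto hν hT hcont hρ hM hR hball1 hlam hlam0 hr₁ hr₁1 hKs hpt hL3 hae hv₁cont y'
  -- ## ZONE 2: eventual uniform bound on balls
  have hBz0 : 0 ≤ max (M / ν) 0 := le_max_right _ _
  have hballB : ∀ L : ℝ, 0 < L → ∃ B : ℝ, ∀ᶠ j in atTop, ∀ y' ∈ ball y L, ‖((lam j) • stPull ((lam j) ^ 2) (lam j) (0 : ℝ) (0 : (EuclideanSpace ℝ (Fin 3))) v') (-1) y'‖ ≤ B := by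
    intro L hL
    refine ⟨max (M / ν) 0, ?_⟩
    have hevL : ∀ᶠ j in atTop, R * (lam j / 2) * (‖y‖ + L) < ρ :=
      Filter.Tendsto.eventually_lt_const hρ (by simpa using hμ0.mul_const (‖y‖ + L))
    filter_upwards [hev, hevL] with j hj hjL y' hy'
    obtain ⟨-, hTI, -, -⟩ := hpkg j hj.1 hj.2.1
    refine (hTI y' ?_).trans (le_max_left _ _)
    have : ‖y'‖ < ‖y‖ + L := by
      have h := mem_ball.1 hy'
      rw [dist_eq_norm] at h
      linarith [norm_le_norm_add_norm_sub' y' y, norm_sub_rev y' y]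
    calc R * (lam j / 2) * ‖y'‖ ≤ R * (lam j / 2) * (‖y‖ + L) := mul_le_mul_of_nonneg_left this.le (hμpos j).le
      _ < ρ := hjL
  -- ## ZONE 3: the two shifted tails of the zoomed slice in the regime
  have hZtails : ∀ j, J ≤ j → (R * (lam j / 2)) ^ 2 < ν * ρ ^ 2 → R * (lam j / 2) * (‖y‖ + 1) ≤ ρ / 4 →
      ∀ L₀ : ℝ, 0 < L₀ →
      (IntegrableOn (fun z => lamK z * ‖((lam j) • stPull ((lam j) ^ 2) (lam j) (0 : ℝ) (0 : (EuclideanSpace ℝ (Fin 3))) v') (-1) (y + z)‖) (ball (0 : EuclideanSpace ℝ (Fin 3)) L₀)ᶜ ∧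
        ∫ z in (ball (0 : EuclideanSpace ℝ (Fin 3)) L₀)ᶜ, lamK z * ‖((lam j) • stPull ((lam j) ^ 2) (lam j) (0 : ℝ) (0 : (EuclideanSpace ℝ (Fin 3))) v') (-1) (y + z)‖ ≤
          max (M / ν) 0 * (c / L₀) + (16 * c / ρ ^ 2 + 64 * E₀ / (ν ^ 2 * ρ ^ 3)) * (R * (lam j / 2)) ^ 2 / 2) ∧
      (IntegrableOn (fun z => lamK z * ‖((lam j) • stPull ((lam j) ^ 2) (lam j) (0 : ℝ) (0 : (EuclideanSpace ℝ (Fin 3))) v') (-1) (y - z)‖) (ball (0 : EuclideanSpace ℝ (Fin 3)) L₀)ᶜ ∧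
        ∫ z in (ball (0 : EuclideanSpace ℝ (Fin 3)) L₀)ᶜ, lamK z * ‖((lam j) • stPull ((lam j) ^ 2) (lam j) (0 : ℝ) (0 : (EuclideanSpace ℝ (Fin 3))) v') (-1) (y - z)‖ ≤
          max (M / ν) 0 * (c / L₀) + (16 * c / ρ ^ 2 + 64 * E₀ / (ν ^ 2 * ρ ^ 3)) * (R * (lam j / 2)) ^ 2 / 2) := by
    intro j hj hj2 hsmall L₀ hL₀
    obtain ⟨hyP, ho⟩ := far_error_le hc0.le hE₀ hν hρ (hμpos j) hsmall
    obtain ⟨hsm, hTI, hi2, hE2⟩ := hpkg j hj hj2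
    have hfB : ∀ w' : EuclideanSpace ℝ (Fin 3), ‖w'‖ < ρ / (2 * (R * (lam j / 2))) → ‖((lam j) • stPull ((lam j) ^ 2) (lam j) (0 : ℝ) (0 : (EuclideanSpace ℝ (Fin 3))) v') (-1) w'‖ ≤ max (M / ν) 0 := by
      intro w' hw'
      refine (hTI w' ?_).trans (le_max_left _ _)
      have h := (lt_div_iff₀ (mul_pos two_pos (hμpos j))).1 hw'
      nlinarith [hμpos j, norm_nonneg w']
    have hZm : AEStronglyMeasurable (((lam j) • stPull ((lam j) ^ 2) (lam j) (0 : ℝ) (0 : (EuclideanSpace ℝ (Fin 3))) v') (-1)) volume := hsm.continuous.aestronglyMeasurable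
    obtain ⟨hip, hvp⟩ := integral_tail_shift_le hc hZm hBz0 hfB hi2 hE2 hyP hL₀
    obtain ⟨him, hvm⟩ := integral_tail_shift_neg_le hc hZm hBz0 hfB hi2 hE2 hyP hL₀
    refine ⟨⟨hip, hvp.trans ?_⟩, ⟨him, hvm.trans ?_⟩⟩ <;> linarith
  -- ## integrability of the zoom's `Λ`-integrand, eventually
  have hint : ∀ᶠ j in atTop, Integrable (fun z => lamK z • ((2 : ℝ) • ((lam j) • stPull ((lam j) ^ 2) (lam j) (0 : ℝ) (0 : (EuclideanSpace ℝ (Fin 3))) v') (-1) y - ((lam j) • stPull ((lam j) ^ 2) (lam j) (0 : ℝ) (0 : (EuclideanSpace ℝ (Fin 3))) v') (-1) (y + z) - ((lam j) • stPull ((lam j) ^ 2) (lam j) (0 : ℝ) (0 : (EuclideanSpace ℝ (Fin 3))) v') (-1) (y - z))) := by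
    filter_upwards [hev] with j hj
    obtain ⟨⟨hip, -⟩, ⟨him, -⟩⟩ := hZtails j hj.1 hj.2.1 hj.2.2 (7 / 8) (by norm_num)
    obtain ⟨hsm, -, -, -⟩ := hpkg j hj.1 hj.2.1
    exact integrable_fracLapHalf_integrand_of_near_of_tails hsm.continuous.aestronglyMeasurable (by norm_num)
      (by positivity) (hnear_of j hj.1 hj.2.1) hip him
  -- ## the tails
  have htail : ∀ ε > 0, ∃ L₀ : ℝ, 0 < L₀ ∧
      (∀ᶠ j in atTop, ∫ z in (ball (0 : EuclideanSpace ℝ (Fin 3)) L₀)ᶜ,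
        lamK z * ‖(2 : ℝ) • ((lam j) • stPull ((lam j) ^ 2) (lam j) (0 : ℝ) (0 : (EuclideanSpace ℝ (Fin 3))) v') (-1) y - ((lam j) • stPull ((lam j) ^ 2) (lam j) (0 : ℝ) (0 : (EuclideanSpace ℝ (Fin 3))) v') (-1) (y + z) - ((lam j) • stPull ((lam j) ^ 2) (lam j) (0 : ℝ) (0 : (EuclideanSpace ℝ (Fin 3))) v') (-1) (y - z)‖ ≤ ε) ∧
      ∫ z in (ball (0 : EuclideanSpace ℝ (Fin 3)) L₀)ᶜ,
        lamK z * ‖(2 : ℝ) • v₁ (-1) y - v₁ (-1) (y + z) - v₁ (-1) (y - z)‖ ≤ ε := by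
    intro ε hε
    obtain ⟨L₀, hL₀pos, hcL⟩ : ∃ L₀ : ℝ, 0 < L₀ ∧ (max (M / ν) 0 + C₁ / Real.sqrt (-(-1 : ℝ)) + 1) * (c / L₀) ≤ ε / 16 := by
      refine ⟨16 * (max (M / ν) 0 + C₁ / Real.sqrt (-(-1 : ℝ)) + 1) * c / ε + 1, by positivity, ?_⟩
      rw [← mul_div_assoc, div_le_iff₀ (by positivity)]
      have e : ε / 16 * (16 * (max (M / ν) 0 + C₁ / Real.sqrt (-(-1 : ℝ)) + 1) * c / ε + 1) =
          (max (M / ν) 0 + C₁ / Real.sqrt (-(-1 : ℝ)) + 1) * c + ε / 16 := by field_simp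
      rw [e]; linarith
    have hcL0 : 0 ≤ c / L₀ := by positivity
    refine ⟨L₀, hL₀pos, ?_, ?_⟩
    · have hev2 : ∀ᶠ j in atTop, (16 * c / ρ ^ 2 + 64 * E₀ / (ν ^ 2 * ρ ^ 3)) * (R * (lam j / 2)) ^ 2 < ε / 8 := by
        have h : Tendsto (fun j => (16 * c / ρ ^ 2 + 64 * E₀ / (ν ^ 2 * ρ ^ 3)) * (R * (lam j / 2)) ^ 2) atTop (𝓝 0) := by
          simpa using (hμ0.pow 2).const_mul (16 * c / ρ ^ 2 + 64 * E₀ / (ν ^ 2 * ρ ^ 3))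
        exact Filter.Tendsto.eventually_lt_const (by positivity) h
      filter_upwards [hev, hev2, hint] with j hj hj3 hji
      obtain ⟨htp, htm⟩ := hZtails j hj.1 hj.2.1 hj.2.2 L₀ hL₀pos
      obtain ⟨-, hTI, -, -⟩ := hpkg j hj.1 hj.2.1
      have hZy : ‖((lam j) • stPull ((lam j) ^ 2) (lam j) (0 : ℝ) (0 : (EuclideanSpace ℝ (Fin 3))) v') (-1) y‖ ≤ max (M / ν) 0 := by
        refine (hTI y ?_).trans (le_max_left _ _)
        nlinarith [norm_nonneg y, hμpos j, hj.2.2]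
      have h := setIntegral_tail_secondDiff_le hc hL₀pos hji hZy htp htm
      have hBz' : max (M / ν) 0 * (c / L₀) ≤ ε / 16 :=
        (mul_le_mul_of_nonneg_right (by linarith) hcL0).trans hcL
      linarith
    · obtain ⟨htp, htm⟩ := integrableOn_tail_of_bounded hc hgc.aestronglyMeasurable hgB y hL₀pos
      have h := setIntegral_tail_secondDiff_le (o := 0) hc hL₀pos hgint (hgB y)
        ⟨htp.1, by linarith [htp.2]⟩ ⟨htm.1, by linarith [htm.2]⟩
      have hCg' : C₁ / Real.sqrt (-(-1 : ℝ)) * (c / L₀) ≤ ε / 16 :=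
        (mul_le_mul_of_nonneg_right (by linarith) hcL0).trans hcL
      linarith
  -- ## assemble the three zones
  exact tendsto_fracLapHalf_of_zones (by norm_num : (0 : ℝ) < 7 / 8) (by positivity) hint hgint hptw hnear hballB htail

end Summit.NavierStokesRegularity.NavierStokesRegularity.Theorems.ChiralWindowDoorZoomLambdaFrame

end
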